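import Literature.Topology.FourManifolds.HandleAttachingMapsInversion
import Literature.Topology.FourManifolds.GluingConstructionBoundary
import HarnessLib

/-!
# Existence of `M ∪ H^λ ∪ ⋯ ∪ H^λ`: attaching finitely many handles yields a manifold

Topic `Literature/Topology/FourManifolds`; proof file below `HandleAttachingMaps.lean`, discharging
its named fact `HandleAttachingMap.exists_isMultiAttachment` (Kosinski, *Differential Manifolds*
(1993), VI §6 with VI §1): for finitely many attaching maps `h̄ᵢ : T → M` of `λ`-handles with
pairwise disjoint ranges on a (Hausdorff, second countable) smooth manifold with boundary `M`,
the identification space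

  `P = (M ∖ ⋃ᵢ h̄ᵢ(S)) ∪ ⋃ᵢ (Dᵐ ∖ S)ᵢ`,  `x ∈ (T ∖ S)ᵢ ∼ h̄ᵢ α(x)`

(`α` Kosinski's inversion (6.1)) is a (Hausdorff, second countable) smooth manifold with boundary,
compact if `M` is, which is `M` with the handles attached
(`HandleAttachingMap.IsMultiAttachment h (𝓡∂ m) P`).

## The construction

* `SpanGlueData I A B C ι` (generic): a manifold `A`, a model handle `B`, and for each `i : ι` a
  *span of open smooth embeddings* `A ← C → B`, `φA i : C → A`, `φB i : C → B`, the `φA i` with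
  pairwise disjoint ranges.  `d.Glued` is the quotient of `A ⊕ (Σ i, B)` by `φA i c ∼ (i, φB i c)`
  — the pushout gluing one copy of `B` to `A` per index.  As for the binary gluing of the tree
  (`SmoothGlueData`, `GluingConstruction.lean`, `GluingConstructionBoundary.lean`), whose proofs are
  followed verbatim: `inl`, `inr i` are open embeddings covering `d.Glued`
  (Kosinski VI §1, proof of (1.1), (∗): "the projections are open maps"); `d.Glued` is Hausdorff
  when the spans have closed images in `A × B` (`t2Space_of_isClosed_link`), compact when covered
  by images of compact sets, second countable when the pieces are; its atlas consists of the lifts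
  of all maximal-atlas charts of the pieces, changes of charts across pieces being conjugates of
  the partial diffeomorphisms `φB i ∘ (φA i)⁻¹` (`instIsManifold`, via the tree's
  `contDiffOn_lift_symm_trans_lift_self`); `inl`, `inr i` are smooth embeddings.
* `HandleAttachingMap.spanGlueData h hdisj` (specific): `A = M ∖ ⋃ᵢ h̄ᵢ(S)`
  (`coresComplement h`), `B = Dᵐ ∖ S` (`beltPiece`), `C = T ∖ S` (`sphereComplTube`),
  `φA i = h̄ᵢ|(T ∖ S)`, `φB i = α|(T ∖ S)`; then `inl a = inr i b ↔ (h i).glueRel a b`.  The images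
  of the spans are closed (`isClosed_link`: a limit point `(a, b)` with `b` on the belt disc would
  have `a` on the attaching sphere `h̄ᵢ(S)`, which is removed — Kosinski's "routine case-by-case
  checking"), so the glued space is Hausdorff; it is compact for compact `M` (covered by the images
  of `M ∖ ⋃ h̄ᵢ{|x_λ|² > 1/2}` and of the `{|x_λ|² ≤ 1/2} ⊆ Dᵐ`).
* `HandleAttachingMap.exists_isMultiAttachment_holds`: the discharge.  (The one-handle fact
  `HandleAttachingMap.exists_isAttachment` is discharged in the sibling file
  `HandleAttachingMapsProofs.lean` with the tree's *binary* gluing `SmoothGlueData`.)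

## Design notes

* Why a new pushout `SpanGlueData` rather than the binary `SmoothGlueData`
  (`GluingConstruction.lean`): `ι` handles need `ι` copies of `Dᵐ ∖ S` glued to one piece
  `M ∖ ⋃ᵢ h̄ᵢ(S)`; Mathlib has no charted-space structure on `Σ i, B` (only on binary sums), and
  an iterated binary gluing changes the ambient type at every step.  The family quotient is built
  once, with the same chart-compatibility lemma (`contDiffOn_lift_symm_trans_lift_self`) as the
  binary case.
* Why spans `A ← C → B` rather than partial homeomorphisms `A ⇀ B`: an
  `OpenPartialHomeomorph A B` carries total maps both ways and does not exist when exactly one of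
  `A`, `B` is empty — which happens here for `M = ∅` (then `λ = 0` or `ι = ∅`, and `P` is a
  disjoint union of discs) — whereas the spans `h̄ᵢ|(T ∖ S)`, `α|(T ∖ S)` always exist; the gluing
  relation `inl a = inr i b ↔ ∃ c, φA i c = a ∧ φB i c = b` is literally Kosinski's
  `HandleAttachingMap.glueRel`.  The partial diffeomorphisms `θᵢ = φB i ∘ (φA i)⁻¹` are only
  formed inside proofs, where the overlap is nonempty.
* The generic part (`SpanGlueData.*`) repeats, for the family, the statements of the binary
  `SmoothGlueData.*` API (`inl_injective`, `isOpenMap_inl`, …); the near-duplication is deliberate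
  (same names, same roles, different structure).

## References

* A. A. Kosinski, *Differential Manifolds*, Academic Press (1993): VI §6 (attaching handles,
  `M ∪ H^λ`, (6.1)), VI §1, proof of (1.1) (smooth structure and Hausdorffness of an
  identification space along a diffeomorphism of open subsets), VI §11 (attaching several handles).
  [Kosinski1993]
* R. C. Kirby, *The Topology of 4-Manifolds*, LNM 1374 (1989), Ch. I §1. [Kirby1989]
-/

open scoped Manifold ContDiff Topology
open Set Function OpenPartialHomeomorph Topology

noncomputable section

namespace Literature.Topology.FourManifolds

universe u uA uB uC uι

/-- Local notation: `𝔼 n` is the model Euclidean space `EuclideanSpace ℝ (Fin n)`. -/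
local notation "𝔼 " n:arg => EuclideanSpace ℝ (Fin n)

/-- Local notation: `𝔻 n` is the closed unit ball in `EuclideanSpace ℝ (Fin n)`. -/
local notation "𝔻 " n:arg => (Metric.closedBall (0 : EuclideanSpace ℝ (Fin n)) 1)

/-! ### Gluing a family of copies of `B` to `A` along spans of open smooth embeddings -/

section Generic

variable {E H : Type*} [NormedAddCommGroup E] [NormedSpace ℝ E] [TopologicalSpace H]

/-- **Gluing datum for a family of handles.**  A manifold `A`, a manifold `B` (the model piece,
one copy of which is glued in per index `i : ι`), a manifold `C` (the model overlap) — all on the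
same model with corners `I` — and for every `i` a span of `C^∞` embeddings with open ranges
`A ← C → B`; the embeddings into `A` have pairwise disjoint ranges.  The glued space identifies
`φA i c ∈ A` with `φB i c` in the `i`-th copy of `B` (Kosinski, *Differential Manifolds*, VI §1 and
VI §6: `x ∈ T ∖ S ∼ h̄ α(x)`, one handle per attaching map). [folklore] -/
structure SpanGlueData (I : ModelWithCorners ℝ E H) (A : Type uA) [TopologicalSpace A]
    [ChartedSpace H A] (B : Type uB) [TopologicalSpace B] [ChartedSpace H B] (C : Type uC)
    [TopologicalSpace C] [ChartedSpace H C] (ι : Type uι) where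
  /-- the overlap embedded in `A`, one embedding per index -/
  φA : ι → C → A
  /-- the overlap embedded in the `i`-th copy of `B` -/
  φB : ι → C → B
  /-- `φA i` is a `C^∞` embedding … -/
  isSmoothEmbedding_φA : ∀ i, Manifold.IsSmoothEmbedding I I ∞ (φA i)
  /-- … with open range -/
  isOpen_range_φA : ∀ i, IsOpen (range (φA i))
  /-- `φB i` is a `C^∞` embedding … -/
  isSmoothEmbedding_φB : ∀ i, Manifold.IsSmoothEmbedding I I ∞ (φB i)
  /-- … with open range -/
  isOpen_range_φB : ∀ i, IsOpen (range (φB i))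
  /-- the gluing regions in `A` are pairwise disjoint -/
  disjoint : Pairwise fun i j => Disjoint (range (φA i)) (range (φA j))

namespace SpanGlueData

variable {I : ModelWithCorners ℝ E H} {A : Type uA} [TopologicalSpace A] [ChartedSpace H A]
  {B : Type uB} [TopologicalSpace B] [ChartedSpace H B] {C : Type uC} [TopologicalSpace C]
  [ChartedSpace H C] {ι : Type uι} (d : SpanGlueData I A B C ι)

/-! #### The pushout as a topological space -/

/-- `φA i` is an open embedding. [folklore] -/
theorem isOpenEmbedding_φA (i : ι) : IsOpenEmbedding (d.φA i) :=
  IsOpenEmbedding.mk (d.isSmoothEmbedding_φA i).isEmbedding (d.isOpen_range_φA i)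

/-- `φB i` is an open embedding. [folklore] -/
theorem isOpenEmbedding_φB (i : ι) : IsOpenEmbedding (d.φB i) :=
  IsOpenEmbedding.mk (d.isSmoothEmbedding_φB i).isEmbedding (d.isOpen_range_φB i)

/-- `φA i` is injective. [folklore] -/
theorem injective_φA (i : ι) : Injective (d.φA i) := (d.isOpenEmbedding_φA i).injective

/-- `φB i` is injective. [folklore] -/
theorem injective_φB (i : ι) : Injective (d.φB i) := (d.isOpenEmbedding_φB i).injective

/-- `φA i` is continuous. [folklore] -/
theorem continuous_φA (i : ι) : Continuous (d.φA i) := (d.isOpenEmbedding_φA i).continuous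

/-- `φB i` is continuous. [folklore] -/
theorem continuous_φB (i : ι) : Continuous (d.φB i) := (d.isOpenEmbedding_φB i).continuous

/-- **The gluing relation of the `i`-th handle**: `a ∈ A` is glued to `b` in the `i`-th copy of
`B` iff `(a, b) = (φA i c, φB i c)` for some point `c` of the overlap. [folklore] -/
def link (i : ι) (a : A) (b : B) : Prop := ∃ c, d.φA i c = a ∧ d.φB i c = b

/-- The pair `(φA i c, φB i c)` is glued. [folklore] -/
theorem link_apply (i : ι) (c : C) : d.link i (d.φA i c) (d.φB i c) := ⟨c, rfl, rfl⟩

/-- Each `a` is glued to at most one point of the `i`-th copy of `B`. [folklore] -/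
theorem link_right_unique {i : ι} {a : A} {b b' : B} (h : d.link i a b) (h' : d.link i a b') :
    b = b' := by
  obtain ⟨c, rfl, rfl⟩ := h
  obtain ⟨c', hc', rfl⟩ := h'
  rw [d.injective_φA i hc']

/-- Each point of the `i`-th copy of `B` is glued to at most one `a`. [folklore] -/
theorem link_left_unique {i : ι} {a a' : A} {b : B} (h : d.link i a b) (h' : d.link i a' b) :
    a = a' := by
  obtain ⟨c, rfl, rfl⟩ := h
  obtain ⟨c', rfl, hc'⟩ := h'
  rw [d.injective_φB i hc']

/-- A point of `A` is glued to at most one copy of `B` (the gluing regions are disjoint).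
[folklore] -/
theorem eq_of_link {i j : ι} {a : A} {b b' : B} (h : d.link i a b) (h' : d.link j a b') : i = j := by
  by_contra hij
  obtain ⟨c, rfl, -⟩ := h
  obtain ⟨c', hc', -⟩ := h'
  exact Set.disjoint_left.1 (d.disjoint hij) (mem_range_self c) ⟨c', hc'⟩

/-- The gluing relation on `A ⊕ (Σ i, B)` generated by `inl (φA i c) ∼ inr (i, φB i c)`; it is
already an equivalence relation. [folklore] -/
def Rel : A ⊕ (Σ _ : ι, B) → A ⊕ (Σ _ : ι, B) → Prop
  | Sum.inl a, Sum.inl a' => a = a'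
  | Sum.inr p, Sum.inr q => p = q
  | Sum.inl a, Sum.inr p => d.link p.1 a p.2
  | Sum.inr p, Sum.inl a => d.link p.1 a p.2

/-- The gluing relation is an equivalence relation. [folklore] -/
theorem rel_equivalence : Equivalence d.Rel where
  refl x := by cases x <;> simp only [Rel]
  symm {x y} h := by
    rcases x with a | ⟨i, b⟩ <;> rcases y with a' | ⟨j, b'⟩ <;> simp only [Rel] at h ⊢
    · exact h.symm
    · exact h
    · exact h
    · exact h.symm
  trans {x y z} h h' := by
    rcases x with a | ⟨i, b⟩ <;> rcases y with a' | ⟨j, b'⟩ <;> rcases z with a'' | ⟨l, b''⟩ <;>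
      simp only [Rel] at h h' ⊢
    · exact h.trans h'
    · rw [h]; exact h'
    · exact d.link_left_unique h h'
    · cases h'; exact h
    · rw [← h']; exact h
    · obtain rfl := d.eq_of_link h h'
      rw [d.link_right_unique h h']
    · cases h; exact h'
    · exact h.trans h'

/-- The gluing setoid on `A ⊕ (Σ i, B)`. [folklore] -/
def glueSetoid : Setoid (A ⊕ (Σ _ : ι, B)) := ⟨d.Rel, d.rel_equivalence⟩

/-- **The glued space** `A ∪ ⋃ᵢ Bᵢ = (A ⊕ Σᵢ B) / (φA i c ∼ (i, φB i c))` (Kosinski, *Differential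
Manifolds*, VI §1, VI §6). [folklore] -/
def Glued : Type (max uA uB uι) := Quotient d.glueSetoid

/-- The quotient topology on the glued space. [folklore] -/
instance instTopologicalSpace : TopologicalSpace d.Glued :=
  inferInstanceAs (TopologicalSpace (Quotient d.glueSetoid))

/-- The quotient map `A ⊕ (Σ i, B) → A ∪ ⋃ᵢ Bᵢ`. [folklore] -/
def proj (x : A ⊕ (Σ _ : ι, B)) : d.Glued := Quotient.mk d.glueSetoid x

/-- The piece `A → A ∪ ⋃ᵢ Bᵢ`. [folklore] -/
def inl (a : A) : d.Glued := d.proj (Sum.inl a)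

/-- The `i`-th copy `B → A ∪ ⋃ᵢ Bᵢ`. [folklore] -/
def inr (i : ι) (b : B) : d.Glued := d.proj (Sum.inr ⟨i, b⟩)

/-- Two points of `A ⊕ (Σ i, B)` have the same image iff they are related. [folklore] -/
theorem proj_eq_proj_iff {x y : A ⊕ (Σ _ : ι, B)} : d.proj x = d.proj y ↔ d.Rel x y :=
  Quotient.eq (r := d.glueSetoid)

/-- `inl` is injective. [folklore] -/
theorem inl_injective : Injective d.inl := fun _ _ h ↦ d.proj_eq_proj_iff.1 h

/-- **The gluing identification**: `inl a = inr i b` iff `(a, b)` is glued by the `i`-th span.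
[folklore] -/
theorem inl_eq_inr_iff {i : ι} {a : A} {b : B} : d.inl a = d.inr i b ↔ d.link i a b :=
  d.proj_eq_proj_iff

/-- Points of two copies of `B` coincide only if the copies and the points do. [folklore] -/
theorem inr_eq_inr_iff {i j : ι} {b b' : B} :
    d.inr i b = d.inr j b' ↔ (⟨i, b⟩ : Σ _ : ι, B) = ⟨j, b'⟩ :=
  d.proj_eq_proj_iff

/-- `inr i` is injective. [folklore] -/
theorem inr_injective (i : ι) : Injective (d.inr i) := fun b b' h ↦ by
  have := d.inr_eq_inr_iff.1 h
  cases this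
  rfl

/-- Points of distinct copies of `B` are distinct. [folklore] -/
theorem fst_eq_of_inr_eq_inr {i j : ι} {b b' : B} (h : d.inr i b = d.inr j b') : i = j := by
  have := d.inr_eq_inr_iff.1 h
  cases this
  rfl

/-- `inl (φA i c) = inr i (φB i c)`. [folklore] -/
theorem inl_φA (i : ι) (c : C) : d.inl (d.φA i c) = d.inr i (d.φB i c) :=
  d.inl_eq_inr_iff.2 (d.link_apply i c)

/-- The quotient map is surjective. [folklore] -/
theorem proj_surjective : Surjective d.proj := Quotient.mk_surjective

/-- The quotient map is a quotient map. [folklore] -/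
theorem isQuotientMap_proj : IsQuotientMap d.proj := isQuotientMap_quotient_mk'

/-- The quotient map is continuous. [folklore] -/
theorem continuous_proj : Continuous d.proj := continuous_quotient_mk'

/-- `inl` is continuous. [folklore] -/
theorem continuous_inl : Continuous d.inl := d.continuous_proj.comp _root_.continuous_inl

/-- `inr i` is continuous. [folklore] -/
theorem continuous_inr (i : ι) : Continuous (d.inr i) :=
  d.continuous_proj.comp (_root_.continuous_inr.comp (continuous_sigmaMk (σ := fun _ : ι => B)))

/-- Every point of the glued space comes from `A` or from some copy of `B`. [folklore] -/
theorem exists_inl_or_inr (p : d.Glued) : (∃ a, d.inl a = p) ∨ ∃ q : ι × B, d.inr q.1 q.2 = p := by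
  obtain ⟨x | ⟨i, b⟩, rfl⟩ := d.proj_surjective p
  · exact Or.inl ⟨x, rfl⟩
  · exact Or.inr ⟨(i, b), rfl⟩

/-- **The pieces cover** the glued space. [folklore] -/
theorem range_inl_union_iUnion_range_inr : range d.inl ∪ ⋃ i, range (d.inr i) = univ := by
  refine eq_univ_of_forall fun p ↦ ?_
  rcases d.exists_inl_or_inr p with ⟨a, rfl⟩ | ⟨q, rfl⟩
  · exact Or.inl ⟨a, rfl⟩
  · exact Or.inr (mem_iUnion.2 ⟨q.1, q.2, rfl⟩)

/-- The copy `B`-slice of the saturation of `inl '' s`: it is `φB i '' (φA i ⁻¹' s)`. [folklore] -/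
theorem preimage_inr_image_inl (i : ι) (s : Set A) :
    d.inr i ⁻¹' (d.inl '' s) = d.φB i '' (d.φA i ⁻¹' s) := by
  ext b
  simp only [mem_preimage, mem_image]
  constructor
  · rintro ⟨a, ha, h⟩
    obtain ⟨c, rfl, rfl⟩ := d.inl_eq_inr_iff.1 h
    exact ⟨c, ha, rfl⟩
  · rintro ⟨c, hc, rfl⟩
    exact ⟨_, hc, d.inl_φA i c⟩

/-- The `A`-part of the saturation of `inr i '' s`: it is `φA i '' (φB i ⁻¹' s)`. [folklore] -/
theorem preimage_inl_image_inr (i : ι) (s : Set B) :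
    d.inl ⁻¹' (d.inr i '' s) = d.φA i '' (d.φB i ⁻¹' s) := by
  ext a
  simp only [mem_preimage, mem_image]
  constructor
  · rintro ⟨b, hb, h⟩
    obtain ⟨c, rfl, rfl⟩ := d.inl_eq_inr_iff.1 h.symm
    exact ⟨c, hb, rfl⟩
  · rintro ⟨c, hc, rfl⟩
    exact ⟨_, hc, (d.inl_φA i c).symm⟩

/-- `inl` is an open map: the saturation of an open `s ⊆ A` meets `A` in `s` and the `i`-th copy of
`B` in the open set `φB i '' (φA i ⁻¹' s)` (Kosinski VI §1, proof of (1.1), (∗)). [folklore] -/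
theorem isOpenMap_inl : IsOpenMap d.inl := by
  intro s hs
  rw [← d.isQuotientMap_proj.isOpen_preimage, isOpen_sum_iff]
  constructor
  · have : Sum.inl ⁻¹' (d.proj ⁻¹' (d.inl '' s)) = s := by
      ext a; exact d.inl_injective.mem_set_image
    rw [this]; exact hs
  · rw [isOpen_sigma_iff]
    intro i
    change IsOpen (d.inr i ⁻¹' (d.inl '' s))
    rw [d.preimage_inr_image_inl]
    exact (d.isOpenEmbedding_φB i).isOpenMap _ (hs.preimage (d.continuous_φA i))

/-- `inr i` is an open map (Kosinski VI §1, proof of (1.1), (∗)). [folklore] -/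
theorem isOpenMap_inr (i : ι) : IsOpenMap (d.inr i) := by
  intro s hs
  rw [← d.isQuotientMap_proj.isOpen_preimage, isOpen_sum_iff]
  constructor
  · change IsOpen (d.inl ⁻¹' (d.inr i '' s))
    rw [d.preimage_inl_image_inr]
    exact (d.isOpenEmbedding_φA i).isOpenMap _ (hs.preimage (d.continuous_φB i))
  · rw [isOpen_sigma_iff]
    intro j
    change IsOpen (d.inr j ⁻¹' (d.inr i '' s))
    by_cases hji : j = i
    · subst hji
      have : d.inr j ⁻¹' (d.inr j '' s) = s := by
        ext b; exact (d.inr_injective j).mem_set_image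
      rw [this]; exact hs
    · have : d.inr j ⁻¹' (d.inr i '' s) = ∅ := by
        refine eq_empty_of_forall_notMem fun b hb => ?_
        obtain ⟨b', -, h⟩ := hb
        exact hji (d.fst_eq_of_inr_eq_inr h).symm
      rw [this]; exact isOpen_empty

/-- **`inl` is an open embedding.** [folklore] -/
theorem isOpenEmbedding_inl : IsOpenEmbedding d.inl :=
  .of_continuous_injective_isOpenMap d.continuous_inl d.inl_injective d.isOpenMap_inl

/-- **`inr i` is an open embedding.** [folklore] -/
theorem isOpenEmbedding_inr (i : ι) : IsOpenEmbedding (d.inr i) :=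
  .of_continuous_injective_isOpenMap (d.continuous_inr i) (d.inr_injective i) (d.isOpenMap_inr i)

/-- The range of `inl` is open. [folklore] -/
theorem isOpen_range_inl : IsOpen (range d.inl) := d.isOpenEmbedding_inl.isOpen_range

/-- The range of `inr i` is open. [folklore] -/
theorem isOpen_range_inr (i : ι) : IsOpen (range (d.inr i)) := (d.isOpenEmbedding_inr i).isOpen_range

/-- Distinct copies of `B` have disjoint images. [folklore] -/
theorem pairwise_disjoint_range_inr : Pairwise fun i j => Disjoint (range (d.inr i)) (range (d.inr j)) := by
  intro i j hij
  rw [Set.disjoint_left]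
  rintro _ ⟨b, rfl⟩ ⟨b', h⟩
  exact hij (d.fst_eq_of_inr_eq_inr h.symm)

/-! #### Separation, compactness, second countability -/

/-- **Hausdorffness of the pushout.** If `A` and `B` are Hausdorff and the image
`{(φA i c, φB i c)}` of every span is closed in `A × B`, the glued space is Hausdorff
(Kosinski, *Differential Manifolds*, VI §1, proof of (1.1); Bourbaki, *General Topology*,
I §8.6). [folklore] -/
theorem t2Space_of_isClosed_link [T2Space A] [T2Space B]
    (h : ∀ i, IsClosed {p : A × B | d.link i p.1 p.2}) : T2Space d.Glued := by
  -- separation of `inl a` from `inr i b` when they differ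
  have key : ∀ (i : ι) (a : A) (b : B), d.inl a ≠ d.inr i b → ∃ u v : Set d.Glued,
      IsOpen u ∧ IsOpen v ∧ d.inl a ∈ u ∧ d.inr i b ∈ v ∧ Disjoint u v := by
    intro i a b hab
    have hmem : (a, b) ∉ {p : A × B | d.link i p.1 p.2} := fun hp ↦ hab (d.inl_eq_inr_iff.2 hp)
    obtain ⟨U, V, hU, hV, haU, hbV, hUV⟩ := isOpen_prod_iff.1 (h i).isOpen_compl a b hmem
    refine ⟨d.inl '' U, d.inr i '' V, d.isOpenMap_inl U hU, d.isOpenMap_inr i V hV,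
      mem_image_of_mem _ haU, mem_image_of_mem _ hbV, ?_⟩
    rw [Set.disjoint_left]
    rintro _ ⟨a', ha', rfl⟩ ⟨b', hb', hb⟩
    exact hUV (mk_mem_prod ha' hb') (d.inl_eq_inr_iff.1 hb.symm)
  rw [t2Space_iff]
  intro p q hpq
  rcases d.exists_inl_or_inr p with ⟨a, rfl⟩ | ⟨⟨i, b⟩, rfl⟩ <;>
    rcases d.exists_inl_or_inr q with ⟨a', rfl⟩ | ⟨⟨j, b'⟩, rfl⟩
  · obtain ⟨U, V, hU, hV, haU, hbV, hUV⟩ := t2_separation fun h ↦ hpq (congrArg d.inl h)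
    refine ⟨d.inl '' U, d.inl '' V, d.isOpenMap_inl U hU, d.isOpenMap_inl V hV,
      mem_image_of_mem _ haU, mem_image_of_mem _ hbV, ?_⟩
    exact (Set.disjoint_image_iff d.inl_injective).2 hUV
  · exact key j a b' hpq
  · obtain ⟨u, v, hu, hv, hau, hbv, huv⟩ := key i a' b (Ne.symm hpq)
    exact ⟨v, u, hv, hu, hbv, hau, huv.symm⟩
  · by_cases hij : i = j
    · subst hij
      obtain ⟨U, V, hU, hV, haU, hbV, hUV⟩ := t2_separation fun h ↦ hpq (congrArg (d.inr i) h)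
      refine ⟨d.inr i '' U, d.inr i '' V, d.isOpenMap_inr i U hU, d.isOpenMap_inr i V hV,
        mem_image_of_mem _ haU, mem_image_of_mem _ hbV, ?_⟩
      exact (Set.disjoint_image_iff (d.inr_injective i)).2 hUV
    · exact ⟨range (d.inr i), range (d.inr j), d.isOpen_range_inr i, d.isOpen_range_inr j,
        mem_range_self _, mem_range_self _, d.pairwise_disjoint_range_inr hij⟩

/-- **Compactness of the pushout** from compact pieces of the pieces: if compact sets `K_A ⊆ A`,
`K_B ⊆ B` have images covering the glued space (finitely many copies of `B`), it is compact.
[folklore] -/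
theorem compactSpace_of_subset [Finite ι] {KA : Set A} {KB : Set B} (hKA : IsCompact KA)
    (hKB : IsCompact KB) (hcover : ∀ p, p ∈ d.inl '' KA ∪ ⋃ i, d.inr i '' KB) :
    CompactSpace d.Glued := by
  refine ⟨?_⟩
  have : (univ : Set d.Glued) = d.inl '' KA ∪ ⋃ i, d.inr i '' KB := (eq_univ_of_forall hcover).symm
  rw [this]
  exact (hKA.image d.continuous_inl).union (isCompact_iUnion fun i => hKB.image (d.continuous_inr i))

/-- **Second countability of the pushout**: the glued space is covered by the open embedded second
countable pieces (Kosinski VI §1, proof of (1.1): "(∗) implies that it is second countable").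
[folklore] -/
theorem secondCountableTopology [SecondCountableTopology A] [SecondCountableTopology B]
    [Countable ι] : SecondCountableTopology d.Glued := by
  have eA : A ≃ₜ range d.inl := d.isOpenEmbedding_inl.toIsEmbedding.toHomeomorph
  have eB : ∀ i, B ≃ₜ range (d.inr i) := fun i => (d.isOpenEmbedding_inr i).toIsEmbedding.toHomeomorph
  haveI : SecondCountableTopology (range d.inl) := eA.symm.secondCountableTopology
  haveI : ∀ i, SecondCountableTopology (range (d.inr i)) := fun i =>
    (eB i).symm.secondCountableTopology
  let U : Option ι → Set d.Glued := fun o => o.elim (range d.inl) fun i => range (d.inr i)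
  haveI : ∀ o, SecondCountableTopology (U o) := fun o => by
    cases o
    · exact (inferInstance : SecondCountableTopology (range d.inl))
    · exact (inferInstance : SecondCountableTopology (range (d.inr _)))
  refine TopologicalSpace.secondCountableTopology_of_countable_cover (U := U) (fun o => ?_) ?_
  · cases o
    · exact d.isOpen_range_inl
    · exact d.isOpen_range_inr _
  · rw [eq_univ_iff_forall]
    intro p
    rcases d.exists_inl_or_inr p with ⟨a, rfl⟩ | ⟨q, rfl⟩
    · exact mem_iUnion.2 ⟨none, mem_range_self a⟩
    · exact mem_iUnion.2 ⟨some q.1, mem_range_self q.2⟩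

/-! #### The gluing partial diffeomorphisms -/

section Theta

variable [Nonempty C]

/-- **The gluing partial diffeomorphism of the `i`-th span**, `θᵢ = φB i ∘ (φA i)⁻¹ : A ⇀ B`
(source `range (φA i)`, target `range (φB i)`); for handles this is Kosinski's `α ∘ h̄⁻¹`.
[folklore] -/
def θ (i : ι) : OpenPartialHomeomorph A B :=
  (openEmbeddingChart (d.isSmoothEmbedding_φA i) (d.isOpen_range_φA i)).symm ≫ₕ
    openEmbeddingChart (d.isSmoothEmbedding_φB i) (d.isOpen_range_φB i)

/-- The source of `θᵢ` is the gluing region `range (φA i)`. [folklore] -/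
@[simp] theorem θ_source (i : ι) : (d.θ i).source = range (d.φA i) := by
  simp [θ]

/-- The target of `θᵢ` is `range (φB i)`. [folklore] -/
@[simp] theorem θ_target (i : ι) : (d.θ i).target = range (d.φB i) := by
  simp [θ]

/-- `θᵢ (φA i c) = φB i c`. [folklore] -/
@[simp] theorem θ_apply_φA (i : ι) (c : C) : d.θ i (d.φA i c) = d.φB i c := by
  simp [θ, openEmbeddingChart_symm_apply]

/-- `θᵢ⁻¹ (φB i c) = φA i c`. [folklore] -/
@[simp] theorem θ_symm_apply_φB (i : ι) (c : C) : (d.θ i).symm (d.φB i c) = d.φA i c := by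
  simp [θ, openEmbeddingChart_symm_apply]

/-- The gluing identification through `θᵢ`: `inl a = inr i b ↔ a ∈ θᵢ.source ∧ θᵢ a = b`.
[folklore] -/
theorem inl_eq_inr_iff_θ (i : ι) (a : A) (b : B) :
    d.inl a = d.inr i b ↔ a ∈ (d.θ i).source ∧ d.θ i a = b := by
  rw [d.inl_eq_inr_iff, θ_source]
  constructor
  · rintro ⟨c, rfl, rfl⟩
    exact ⟨mem_range_self c, d.θ_apply_φA i c⟩
  · rintro ⟨⟨c, rfl⟩, h⟩
    exact ⟨c, rfl, by rw [← h, d.θ_apply_φA]⟩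

/-- The gluing identification through `θᵢ⁻¹`. [folklore] -/
theorem inr_eq_inl_iff_θ_symm (i : ι) (b : B) (a : A) :
    d.inr i b = d.inl a ↔ b ∈ (d.θ i).symm.source ∧ (d.θ i).symm b = a := by
  rw [eq_comm, d.inl_eq_inr_iff_θ i]
  constructor
  · rintro ⟨ha, rfl⟩; exact ⟨(d.θ i).map_source ha, (d.θ i).left_inv ha⟩
  · rintro ⟨hb, rfl⟩; exact ⟨(d.θ i).map_target hb, (d.θ i).right_inv hb⟩

/-- `θᵢ` is `C^∞` on its source. [folklore] -/
theorem contMDiffOn_θ (i : ι) : ContMDiffOn I I ∞ (d.θ i) (d.θ i).source := by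
  have h1 : ContMDiffOn I I ∞
      (openEmbeddingChart (d.isSmoothEmbedding_φA i) (d.isOpen_range_φA i)).symm
      (range (d.φA i)) := by
    simpa using contMDiffOn_openEmbeddingChart_symm (d.isSmoothEmbedding_φA i)
      (d.isOpen_range_φA i)
  rw [θ_source]
  refine ((d.isSmoothEmbedding_φB i).contMDiff.comp_contMDiffOn h1).congr fun a _ => ?_
  simp [θ]

/-- `θᵢ⁻¹` is `C^∞` on the target. [folklore] -/
theorem contMDiffOn_θ_symm (i : ι) : ContMDiffOn I I ∞ (d.θ i).symm (d.θ i).target := by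
  have h1 : ContMDiffOn I I ∞
      (openEmbeddingChart (d.isSmoothEmbedding_φB i) (d.isOpen_range_φB i)).symm
      (range (d.φB i)) := by
    simpa using contMDiffOn_openEmbeddingChart_symm (d.isSmoothEmbedding_φB i)
      (d.isOpen_range_φB i)
  rw [θ_target]
  refine ((d.isSmoothEmbedding_φA i).contMDiff.comp_contMDiffOn h1).congr fun b _ => ?_
  simp [θ]

end Theta

/-! #### The smooth structure -/

section Charts

variable [Nonempty H]

/-- The chart of the glued space obtained from a chart `e` of `A`: on `inl '' e.source` it is
`e ∘ inl⁻¹` (Kosinski, VI §1). [folklore] -/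
def chartA (e : OpenPartialHomeomorph A H) : OpenPartialHomeomorph d.Glued H :=
  e.lift_openEmbedding d.isOpenEmbedding_inl

/-- The source of `chartA e` is `inl '' e.source`. [folklore] -/
@[simp] theorem chartA_source (e : OpenPartialHomeomorph A H) :
    (d.chartA e).source = d.inl '' e.source := rfl

/-- `chartA e (inl a) = e a`. [folklore] -/
@[simp] theorem chartA_apply_inl (e : OpenPartialHomeomorph A H) (a : A) :
    d.chartA e (d.inl a) = e a := by
  rw [chartA, lift_openEmbedding_apply]

/-- The inverse of `chartA e` is `inl ∘ e.symm`. [folklore] -/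
theorem chartA_symm (e : OpenPartialHomeomorph A H) :
    ((d.chartA e).symm : H → d.Glued) = d.inl ∘ e.symm := by
  rw [chartA, lift_openEmbedding_symm]

/-- The chart of the glued space obtained from a chart `e` of the `i`-th copy of `B`.
[folklore] -/
def chartB (i : ι) (e : OpenPartialHomeomorph B H) : OpenPartialHomeomorph d.Glued H :=
  e.lift_openEmbedding (d.isOpenEmbedding_inr i)

/-- The source of `chartB i e` is `inr i '' e.source`. [folklore] -/
@[simp] theorem chartB_source (i : ι) (e : OpenPartialHomeomorph B H) :
    (d.chartB i e).source = d.inr i '' e.source := rfl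

/-- `chartB i e (inr i b) = e b`. [folklore] -/
@[simp] theorem chartB_apply_inr (i : ι) (e : OpenPartialHomeomorph B H) (b : B) :
    d.chartB i e (d.inr i b) = e b := by
  rw [chartB, lift_openEmbedding_apply]

/-- The inverse of `chartB i e` is `inr i ∘ e.symm`. [folklore] -/
theorem chartB_symm (i : ι) (e : OpenPartialHomeomorph B H) :
    ((d.chartB i e).symm : H → d.Glued) = d.inr i ∘ e.symm := by
  rw [chartB, lift_openEmbedding_symm]

/-- Charts coming from `A` and from a copy of `B` do not overlap when the overlap manifold `C`
is empty. [folklore] -/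
theorem chartA_symm_trans_chartB_source [IsEmpty C] (f : OpenPartialHomeomorph A H) (j : ι)
    (f' : OpenPartialHomeomorph B H) : ((d.chartA f).symm ≫ₕ d.chartB j f').source = ∅ := by
  refine eq_empty_of_forall_notMem fun u hu => ?_
  rw [trans_source] at hu
  obtain ⟨-, hu⟩ := hu
  rw [mem_preimage, chartB_source, chartA_symm] at hu
  obtain ⟨b, -, hb⟩ := hu
  obtain ⟨c, -, -⟩ := d.inl_eq_inr_iff.1 hb.symm
  exact IsEmpty.false c

/-- Charts coming from a copy of `B` and from `A` do not overlap when `C` is empty. [folklore] -/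
theorem chartB_symm_trans_chartA_source [IsEmpty C] (i : ι) (f : OpenPartialHomeomorph B H)
    (f' : OpenPartialHomeomorph A H) : ((d.chartB i f).symm ≫ₕ d.chartA f').source = ∅ := by
  refine eq_empty_of_forall_notMem fun u hu => ?_
  rw [trans_source] at hu
  obtain ⟨-, hu⟩ := hu
  rw [mem_preimage, chartA_source, chartB_symm] at hu
  obtain ⟨a, -, ha⟩ := hu
  obtain ⟨c, -, -⟩ := d.inl_eq_inr_iff.1 ha
  exact IsEmpty.false c

/-- Charts coming from distinct copies of `B` do not overlap. [folklore] -/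
theorem chartB_symm_trans_chartB_source {i j : ι} (hij : i ≠ j) (f f' : OpenPartialHomeomorph B H) :
    ((d.chartB i f).symm ≫ₕ d.chartB j f').source = ∅ := by
  refine eq_empty_of_forall_notMem fun u hu => ?_
  rw [trans_source] at hu
  obtain ⟨-, hu⟩ := hu
  rw [mem_preimage, chartB_source, chartB_symm] at hu
  obtain ⟨b, -, hb⟩ := hu
  exact hij (d.fst_eq_of_inr_eq_inr hb.symm)

omit [Nonempty H] in
/-- A change of charts with empty domain satisfies the compatibility condition of
`contDiffGroupoid ∞ I` trivially. [folklore] -/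
theorem contDiffOn_coordChange_of_source_eq_empty {X : Type*} [TopologicalSpace X]
    {e e' : OpenPartialHomeomorph X H} (h : (e.symm ≫ₕ e').source = ∅) :
    ContDiffOn ℝ ∞ (I ∘ (e.symm ≫ₕ e') ∘ I.symm) (I.symm ⁻¹' (e.symm ≫ₕ e').source ∩ range I) := by
  rw [h, preimage_empty, empty_inter]
  exact contDiffOn_empty

variable [IsManifold I ∞ A] [IsManifold I ∞ B]

/-- **The glued space as a charted space** on `H`: the atlas consists of the lifts along `inl`,
`inr i` of all charts in the maximal `C^∞` atlases of the pieces (Kosinski, *Differential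
Manifolds*, VI §1). [folklore] -/
instance instChartedSpace : ChartedSpace H d.Glued where
  atlas := {e | (∃ f ∈ IsManifold.maximalAtlas I ∞ A, d.chartA f = e) ∨
    ∃ i, ∃ f ∈ IsManifold.maximalAtlas I ∞ B, d.chartB i f = e}
  chartAt p := by
    classical
    exact if h : ∃ a, d.inl a = p then d.chartA (chartAt H (Classical.choose h))
      else d.chartB (Classical.choose ((d.exists_inl_or_inr p).resolve_left h)).1
        (chartAt H (Classical.choose ((d.exists_inl_or_inr p).resolve_left h)).2)
  mem_chart_source p := by
    by_cases h : ∃ a, d.inl a = p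
    · simp only [h, ↓reduceDIte, chartA_source]
      exact ⟨_, mem_chart_source _ _, Classical.choose_spec h⟩
    · simp only [h, ↓reduceDIte, chartB_source]
      exact ⟨_, mem_chart_source _ _,
        Classical.choose_spec ((d.exists_inl_or_inr p).resolve_left h)⟩
  chart_mem_atlas p := by
    by_cases h : ∃ a, d.inl a = p
    · simp only [h, ↓reduceDIte]
      exact Or.inl ⟨_, IsManifold.chart_mem_maximalAtlas _, rfl⟩
    · simp only [h, ↓reduceDIte]
      exact Or.inr ⟨_, _, IsManifold.chart_mem_maximalAtlas _, rfl⟩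

/-- Description of the atlas of the glued space. [folklore] -/
theorem mem_atlas_iff {e : OpenPartialHomeomorph d.Glued H} :
    e ∈ atlas H d.Glued ↔ (∃ f ∈ IsManifold.maximalAtlas I ∞ A, d.chartA f = e) ∨
      ∃ i, ∃ f ∈ IsManifold.maximalAtlas I ∞ B, d.chartB i f = e :=
  Iff.rfl

/-- Lifts of maximal-atlas charts of `A` are charts of the glued space. [folklore] -/
theorem chartA_mem_atlas {f : OpenPartialHomeomorph A H}
    (hf : f ∈ IsManifold.maximalAtlas I ∞ A) : d.chartA f ∈ atlas H d.Glued :=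
  Or.inl ⟨f, hf, rfl⟩

/-- Lifts of maximal-atlas charts of `B` along `inr i` are charts of the glued space. [folklore] -/
theorem chartB_mem_atlas (i : ι) {f : OpenPartialHomeomorph B H}
    (hf : f ∈ IsManifold.maximalAtlas I ∞ B) : d.chartB i f ∈ atlas H d.Glued :=
  Or.inr ⟨i, f, hf, rfl⟩


/-- **The glued space is a smooth manifold** (model `I`, possibly with boundary): changes of
charts within one piece are changes of maximal-atlas charts, across `A` and a copy of `B` they
are conjugates of the gluing partial diffeomorphism `θᵢ`, and distinct copies of `B` do not
overlap (`contDiffOn_lift_symm_trans_lift_self`; Kosinski, *Differential Manifolds*, VI §1,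
proof of (1.1)). [folklore] -/
instance instIsManifold : IsManifold I ∞ d.Glued := by
  refine isManifold_of_contDiffOn _ _ _ ?_
  rintro e e' (⟨f, hf, rfl⟩ | ⟨i, f, hf, rfl⟩) (⟨f', hf', rfl⟩ | ⟨j, f', hf', rfl⟩)
  · exact contDiffOn_lift_symm_trans_lift_self d.isOpenEmbedding_inl d.isOpenEmbedding_inl
      (OpenPartialHomeomorph.refl A) contMDiff_id.contMDiffOn
      (fun m m' ↦ by simp [d.inl_injective.eq_iff]) hf hf'
  · rcases isEmpty_or_nonempty C with hC | hC
    · exact contDiffOn_coordChange_of_source_eq_empty (d.chartA_symm_trans_chartB_source f j f')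
    · exact contDiffOn_lift_symm_trans_lift_self d.isOpenEmbedding_inl (d.isOpenEmbedding_inr j)
        (d.θ j) (d.contMDiffOn_θ j) (fun a b ↦ d.inl_eq_inr_iff_θ j a b) hf hf'
  · rcases isEmpty_or_nonempty C with hC | hC
    · exact contDiffOn_coordChange_of_source_eq_empty (d.chartB_symm_trans_chartA_source i f f')
    · exact contDiffOn_lift_symm_trans_lift_self (d.isOpenEmbedding_inr i) d.isOpenEmbedding_inl
        (d.θ i).symm (d.contMDiffOn_θ_symm i) (fun b a ↦ d.inr_eq_inl_iff_θ_symm i b a) hf hf'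
  · by_cases hij : i = j
    · subst hij
      exact contDiffOn_lift_symm_trans_lift_self (d.isOpenEmbedding_inr i) (d.isOpenEmbedding_inr i)
        (OpenPartialHomeomorph.refl B) contMDiff_id.contMDiffOn
        (fun m m' ↦ by simp [(d.inr_injective i).eq_iff]) hf hf'
    · exact contDiffOn_coordChange_of_source_eq_empty (d.chartB_symm_trans_chartB_source hij f f')

/-! #### Smooth embeddings into the glued space -/

section Immersion

variable {F : Type*} [NormedAddCommGroup F] [NormedSpace ℝ F]
  {E_Q H_Q : Type*} [NormedAddCommGroup E_Q] [NormedSpace ℝ E_Q] [TopologicalSpace H_Q]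
  {I_Q : ModelWithCorners ℝ E_Q H_Q} {Q : Type*} [TopologicalSpace Q] [ChartedSpace H_Q Q]

/-- **`inl ∘ g` is an immersion where `g` is.** If `g : Q → A` is a `C^∞` immersion at `q` with
complement `F` (charts `φ`, `χ` in which `g` reads `u ↦ L (u, 0)`), then so is
`inl ∘ g : Q → A ∪ ⋃ᵢ Bᵢ`, with the lifted chart `chartA χ`. [folklore] -/
theorem isImmersionAtOfComplement_inl_comp {g : Q → A} {q : Q}
    (hg : Manifold.IsImmersionAtOfComplement F I_Q I ∞ g q) :
    Manifold.IsImmersionAtOfComplement F I_Q I ∞ (d.inl ∘ g) q := by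
  refine Manifold.IsImmersionAtOfComplement.mk_of_charts hg.equiv hg.domChart
    (d.chartA hg.codChart) hg.mem_domChart_source ?_ hg.domChart_mem_maximalAtlas
    (IsManifold.subset_maximalAtlas (d.chartA_mem_atlas hg.codChart_mem_maximalAtlas)) ?_ ?_
  · exact ⟨_, hg.mem_codChart_source, rfl⟩
  · intro x hx
    exact ⟨_, hg.source_subset_preimage_source hx, rfl⟩
  · intro u hu
    have h := hg.writtenInCharts hu
    simp only [comp_apply, extend_coe] at h
    simp only [comp_apply, extend_coe, chartA_apply_inl]
    rw [h]

/-- **`inr i ∘ g` is an immersion where `g` is.** [folklore] -/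
theorem isImmersionAtOfComplement_inr_comp (i : ι) {g : Q → B} {q : Q}
    (hg : Manifold.IsImmersionAtOfComplement F I_Q I ∞ g q) :
    Manifold.IsImmersionAtOfComplement F I_Q I ∞ (d.inr i ∘ g) q := by
  refine Manifold.IsImmersionAtOfComplement.mk_of_charts hg.equiv hg.domChart
    (d.chartB i hg.codChart) hg.mem_domChart_source ?_ hg.domChart_mem_maximalAtlas
    (IsManifold.subset_maximalAtlas (d.chartB_mem_atlas i hg.codChart_mem_maximalAtlas)) ?_ ?_
  · exact ⟨_, hg.mem_codChart_source, rfl⟩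
  · intro x hx
    exact ⟨_, hg.source_subset_preimage_source hx, rfl⟩
  · intro u hu
    have h := hg.writtenInCharts hu
    simp only [comp_apply, extend_coe] at h
    simp only [comp_apply, extend_coe, chartB_apply_inr]
    rw [h]

/-- A smooth embedding into `A` composed with `inl` is a smooth embedding into the glued space.
[folklore] -/
theorem isSmoothEmbedding_inl_comp {g : Q → A} (hg : Manifold.IsSmoothEmbedding I_Q I ∞ g) :
    Manifold.IsSmoothEmbedding I_Q I ∞ (d.inl ∘ g) := by
  obtain ⟨⟨F', _, _, hF⟩, hemb⟩ := hg
  exact ⟨Manifold.IsImmersionOfComplement.isImmersion fun q ↦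
    d.isImmersionAtOfComplement_inl_comp (hF q), d.isOpenEmbedding_inl.isEmbedding.comp hemb⟩

/-- A smooth embedding into `B` composed with `inr i` is a smooth embedding into the glued
space. [folklore] -/
theorem isSmoothEmbedding_inr_comp (i : ι) {g : Q → B}
    (hg : Manifold.IsSmoothEmbedding I_Q I ∞ g) :
    Manifold.IsSmoothEmbedding I_Q I ∞ (d.inr i ∘ g) := by
  obtain ⟨⟨F', _, _, hF⟩, hemb⟩ := hg
  exact ⟨Manifold.IsImmersionOfComplement.isImmersion fun q ↦
    d.isImmersionAtOfComplement_inr_comp i (hF q), (d.isOpenEmbedding_inr i).isEmbedding.comp hemb⟩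

/-- **`inl : A → A ∪ ⋃ᵢ Bᵢ` is a smooth embedding** (Kosinski, VI §1: "the unique structure for
which the projections are diffeomorphisms"). [folklore] -/
theorem isSmoothEmbedding_inl : Manifold.IsSmoothEmbedding I I ∞ d.inl :=
  d.isSmoothEmbedding_inl_comp Manifold.IsSmoothEmbedding.id

/-- **`inr i : B → A ∪ ⋃ᵢ Bᵢ` is a smooth embedding.** [folklore] -/
theorem isSmoothEmbedding_inr (i : ι) : Manifold.IsSmoothEmbedding I I ∞ (d.inr i) :=
  d.isSmoothEmbedding_inr_comp i Manifold.IsSmoothEmbedding.id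

end Immersion

end Charts

end SpanGlueData

end Generic

/-! ### Handles: the span `M ∖ ⋃ᵢ h̄ᵢ(S) ← T ∖ S → Dᵐ ∖ S` -/

section Handles

variable (n k : ℕ)

/-- **`T ∖ S = {y ∈ T | |y_λ|² ≠ 1}`**, the tube with the attaching sphere removed, as an open
subset of Kosinski's tube `T` (the common source of `h̄|(T ∖ S)` and `α|(T ∖ S)` in the
identification `x ∼ h̄ α(x)`). [cite: Kosinski1993, VI §6] -/
def sphereComplTube : TopologicalSpace.Opens ↥(handleTube n k) :=
  ⟨{y | lamSq k (((y : 𝔻 (n + 1)) : 𝔼 (n + 1))) ≠ 1},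
    isOpen_ne.preimage (continuous_lamSq_handleTube n k)⟩

/-- Membership in `T ∖ S`: `|y_λ|² ≠ 1`. [cite: Kosinski1993, VI §6] -/
@[simp] theorem mem_sphereComplTube {y : ↥(handleTube n k)} :
    y ∈ sphereComplTube n k ↔ lamSq k (((y : 𝔻 (n + 1)) : 𝔼 (n + 1))) ≠ 1 := Iff.rfl

variable {n k}

/-- `0 < |y_λ|²` on `T ∖ S`. [folklore] -/
theorem lamSq_pos_of_sphereComplTube (c : ↥(sphereComplTube n k)) :
    0 < lamSq k ((((c : ↥(handleTube n k)) : 𝔻 (n + 1)) : 𝔼 (n + 1))) :=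
  lt_of_le_of_ne (lamSq_nonneg k _) (Ne.symm (c : ↥(handleTube n k)).2)

/-- `|y_λ|² < 1` on `T ∖ S`. [folklore] -/
theorem lamSq_lt_one_of_sphereComplTube (c : ↥(sphereComplTube n k)) :
    lamSq k ((((c : ↥(handleTube n k)) : 𝔻 (n + 1)) : 𝔼 (n + 1))) < 1 :=
  lt_of_le_of_ne (lamSq_le_one (mem_closedBall_zero_iff.1 ((c : ↥(handleTube n k)) : 𝔻 (n + 1)).2))
    c.2

/-- **`α|(T ∖ S) : T ∖ S → Dᵐ ∖ S`**, Kosinski's inversion on the tube minus the attaching sphere,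
with values in the handle piece (formula (6.1); values off the belt disc and off `S`,
`handleInversion_mem`). [cite: Kosinski1993, VI (6.1)] -/
def handleInversionBelt (c : ↥(sphereComplTube n k)) : ↥(beltPiece n k) :=
  ⟨⟨handleInversion k ((((c : ↥(handleTube n k)) : 𝔻 (n + 1)) : 𝔼 (n + 1))),
      (handleInversion_mem (c : ↥(handleTube n k)).2 c.2).1⟩,
    (handleInversion_mem (c : ↥(handleTube n k)).2 c.2).2.2⟩

/-- The underlying vector of `α c`. [folklore] -/
@[simp] theorem coe_coe_handleInversionBelt (c : ↥(sphereComplTube n k)) :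
    (((handleInversionBelt c : ↥(beltPiece n k)) : 𝔻 (n + 1)) : 𝔼 (n + 1)) =
      handleInversion k ((((c : ↥(handleTube n k)) : 𝔻 (n + 1)) : 𝔼 (n + 1))) := rfl

/-- `α c` lies off the belt disc: `|α(c)_λ|² ≠ 0`. [cite: Kosinski1993, VI §6] -/
theorem lamSq_handleInversionBelt_ne_zero (c : ↥(sphereComplTube n k)) :
    lamSq k (((handleInversionBelt c : ↥(beltPiece n k)) : 𝔻 (n + 1)) : 𝔼 (n + 1)) ≠ 0 :=
  (handleInversion_mem (c : ↥(handleTube n k)).2 c.2).2.1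

/-- `|α(c)_λ|² = 1 - |c_λ|²`. [cite: Kosinski1993, VI (6.1)] -/
theorem lamSq_handleInversionBelt (c : ↥(sphereComplTube n k)) :
    lamSq k (((handleInversionBelt c : ↥(beltPiece n k)) : 𝔻 (n + 1)) : 𝔼 (n + 1)) =
      1 - lamSq k ((((c : ↥(handleTube n k)) : 𝔻 (n + 1)) : 𝔼 (n + 1))) := by
  rw [coe_coe_handleInversionBelt]
  exact lamSq_handleInversion (lamSq_pos_of_sphereComplTube c)
    (lamSq_lt_one_of_sphereComplTube c).le

/-- `α|(T ∖ S)` is the restriction of the partial diffeomorphism `α : Dᵐ ∖ S ⇀ T`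
(`handleInversionPH`) read backwards. [folklore] -/
theorem handleInversionBelt_eq [Nonempty ↥(handleTube n k)] (c : ↥(sphereComplTube n k)) :
    handleInversionBelt c = (handleInversionPH n k).symm (c : ↥(handleTube n k)) := rfl

/-- `α (α c) = c`: the point `α c` of `Dᵐ ∖ S` is sent back to `c` by `α : Dᵐ ∖ S ⇀ T`.
[cite: Kosinski1993, VI §6] -/
theorem handleInversionPH_handleInversionBelt [Nonempty ↥(handleTube n k)]
    (c : ↥(sphereComplTube n k)) :
    handleInversionPH n k (handleInversionBelt c) = (c : ↥(handleTube n k)) := by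
  rw [handleInversionBelt_eq]
  exact (handleInversionPH n k).right_inv c.2

/-- The range of `α|(T ∖ S)` is `T ∖ S = {x_λ ≠ 0} ⊆ Dᵐ ∖ S`. [cite: Kosinski1993, VI §6] -/
theorem range_handleInversionBelt :
    range (handleInversionBelt (n := n) (k := k)) =
      {b : ↥(beltPiece n k) | lamSq k (((b : 𝔻 (n + 1)) : 𝔼 (n + 1))) ≠ 0} := by
  refine Subset.antisymm ?_ fun b hb => ?_
  · rintro _ ⟨c, rfl⟩
    exact lamSq_handleInversionBelt_ne_zero c
  · have hb0 : lamSq k (((b : 𝔻 (n + 1)) : 𝔼 (n + 1))) ≠ 0 := hb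
    refine ⟨⟨handleInversionPt (b : 𝔻 (n + 1)) hb0 b.2, (handleInversion_mem hb0 b.2).2.2⟩, ?_⟩
    apply Subtype.ext; apply Subtype.ext
    exact handleInversion_handleInversion (lt_of_le_of_ne (lamSq_nonneg k _) (Ne.symm hb0))
      (lt_of_le_of_ne (lamSq_le_one (mem_closedBall_zero_iff.1 (b : 𝔻 (n + 1)).2)) b.2)

/-- The range of `α|(T ∖ S)` is open. [folklore] -/
theorem isOpen_range_handleInversionBelt : IsOpen (range (handleInversionBelt (n := n) (k := k))) := by
  rw [range_handleInversionBelt]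
  exact isOpen_ne.preimage (continuous_lamSq_beltPiece n k)

/-- **`α|(T ∖ S) : T ∖ S → Dᵐ ∖ S` is a smooth embedding** (it is a restriction of the partial
diffeomorphism `α`, `contMDiffOn_handleInversionPH(_symm)`). [cite: Kosinski1993, VI (6.1)] -/
theorem isSmoothEmbedding_handleInversionBelt :
    Manifold.IsSmoothEmbedding (𝓡∂ (n + 1)) (𝓡∂ (n + 1)) ∞
      (handleInversionBelt (n := n) (k := k)) := by
  rcases isEmpty_or_nonempty ↥(handleTube n k) with hT | hT
  · haveI : IsEmpty ↥(sphereComplTube n k) := ⟨fun c => hT.false c.1⟩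
    exact ⟨Manifold.IsImmersionOfComplement.isImmersion (F := PUnit.{1})
      fun c => (IsEmpty.false c).elim, IsEmbedding.of_subsingleton _⟩
  set Ψ := (handleInversionPH n k).symm with hΨ
  have hΨs : ContMDiffOn (𝓡∂ (n + 1)) (𝓡∂ (n + 1)) ∞ Ψ Ψ.source :=
    contMDiffOn_handleInversionPH_symm n k
  have hΨ's : ContMDiffOn (𝓡∂ (n + 1)) (𝓡∂ (n + 1)) ∞ Ψ.symm Ψ.target := by
    rw [hΨ, symm_symm, symm_target]
    exact contMDiffOn_handleInversionPH n k
  have hfun : (handleInversionBelt (n := n) (k := k)) = Ψ ∘ Subtype.val := rfl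
  have himm : Manifold.IsImmersionOfComplement PUnit.{1} (𝓡∂ (n + 1)) (𝓡∂ (n + 1)) ∞
      (handleInversionBelt (n := n) (k := k)) := by
    intro c
    rw [hfun]
    exact (Manifold.IsImmersionAtOfComplement.of_opens (I := 𝓡∂ (n + 1)) (n := ∞)
      (sphereComplTube n k) c).openPartialHomeomorph_comp Ψ hΨs hΨ's c.2
  refine ⟨himm.isImmersion, ?_⟩
  -- an injective continuous open map is an embedding
  have hcont : Continuous (handleInversionBelt (n := n) (k := k)) := by
    rw [hfun]
    exact Ψ.continuousOn.comp_continuous continuous_subtype_val fun c => c.2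
  have hinj : Injective (handleInversionBelt (n := n) (k := k)) := by
    intro c c' hcc'
    have := congrArg (handleInversionPH n k) hcc'
    rw [handleInversionPH_handleInversionBelt, handleInversionPH_handleInversionBelt] at this
    exact Subtype.ext this
  have hopen : IsOpenMap (handleInversionBelt (n := n) (k := k)) := by
    intro U hU
    have hU' : IsOpen (Subtype.val '' U : Set ↥(handleTube n k)) :=
      (sphereComplTube n k).isOpen.isOpenMap_subtype_val U hU
    have := Ψ.isOpen_image_of_subset_source hU' (by
      rintro _ ⟨c, -, rfl⟩; exact c.2)
    rwa [← image_comp, ← hfun] at this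
  exact (IsOpenEmbedding.of_continuous_injective_isOpenMap hcont hinj hopen).isEmbedding

variable {M : Type u} [TopologicalSpace M] [T2Space M] [ChartedSpace (EuclideanHalfSpace (n + 1)) M]
  {ι : Type} [Finite ι]

namespace HandleAttachingMap

/-- **`h̄ᵢ(T ∖ S) ⊆ M ∖ ⋃ⱼ h̄ⱼ(S)`** for attaching maps with pairwise disjoint ranges: off its own
attaching sphere by injectivity, off the others by disjointness. [cite: Kosinski1993, VI §6] -/
theorem apply_mem_coresComplement (h : ι → HandleAttachingMap n k M)
    (hdisj : Pairwise fun i j => Disjoint (range (h i).toFun) (range (h j).toFun)) (i : ι)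
    (c : ↥(sphereComplTube n k)) : (h i).toFun c ∈ coresComplement h := by
  rw [mem_coresComplement]
  intro j
  by_cases hji : j = i
  · subst hji
    rintro ⟨y, hy, he⟩
    have := (h j).injective he
    subst this
    exact c.2 hy
  · rintro ⟨y, -, he⟩
    refine Set.disjoint_left.1 (hdisj hji) (mem_range_self y) ?_
    rw [he]
    exact mem_range_self _

variable [IsManifold (𝓡∂ (n + 1)) ∞ M]

/-- **`h̄ᵢ|(T ∖ S) : T ∖ S → M ∖ ⋃ⱼ h̄ⱼ(S)` is a smooth embedding** (restriction and corestriction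
of the smooth embedding `h̄ᵢ` to open subsets). [folklore] -/
theorem isSmoothEmbedding_restrict (h : ι → HandleAttachingMap n k M)
    (hdisj : Pairwise fun i j => Disjoint (range (h i).toFun) (range (h j).toFun)) (i : ι) :
    Manifold.IsSmoothEmbedding (𝓡∂ (n + 1)) (𝓡∂ (n + 1)) ∞
      fun c : ↥(sphereComplTube n k) =>
        (⟨(h i).toFun c, apply_mem_coresComplement h hdisj i c⟩ : ↥(coresComplement h)) := by
  obtain ⟨⟨F, _, _, hF⟩, hemb⟩ := (h i).isSmoothEmbedding
  refine ⟨Manifold.IsImmersionOfComplement.isImmersion (F := F) fun c => ?_, ?_⟩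
  · exact ((hF (c : ↥(handleTube n k))).comp_subtypeVal (sphereComplTube n k)).codRestrict_opens
      (coresComplement h) (fun c' => apply_mem_coresComplement h hdisj i c')
  · exact (hemb.comp IsEmbedding.subtypeVal).codRestrict _ _

omit [IsManifold (𝓡∂ (n + 1)) ∞ M] in
/-- The range of `h̄ᵢ|(T ∖ S)` in `M ∖ ⋃ⱼ h̄ⱼ(S)` is open (`h̄ᵢ` is an open map). [folklore] -/
theorem isOpen_range_restrict (h : ι → HandleAttachingMap n k M)
    (hdisj : Pairwise fun i j => Disjoint (range (h i).toFun) (range (h j).toFun)) (i : ι) :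
    IsOpen (range fun c : ↥(sphereComplTube n k) =>
      (⟨(h i).toFun c, apply_mem_coresComplement h hdisj i c⟩ : ↥(coresComplement h))) := by
  have : (range fun c : ↥(sphereComplTube n k) =>
      (⟨(h i).toFun c, apply_mem_coresComplement h hdisj i c⟩ : ↥(coresComplement h))) =
      Subtype.val ⁻¹' ((h i).toFun '' (sphereComplTube n k : Set ↥(handleTube n k))) := by
    ext a
    constructor
    · rintro ⟨c, rfl⟩
      exact ⟨c, c.2, rfl⟩
    · rintro ⟨y, hy, hya⟩
      exact ⟨⟨y, hy⟩, Subtype.ext hya⟩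
  rw [this]
  refine IsOpen.preimage continuous_subtype_val ?_
  exact (IsOpenEmbedding.mk (h i).isSmoothEmbedding.isEmbedding (h i).isOpen_range).isOpenMap _
    (sphereComplTube n k).isOpen

/-- **The handle gluing datum**: the spans `M ∖ ⋃ⱼ h̄ⱼ(S) ← T ∖ S → Dᵐ ∖ S`,
`c ↦ h̄ᵢ c`, `c ↦ α c`, one per handle — Kosinski's identification `x ∼ h̄ᵢ α(x)` of
`x ∈ (T ∖ S)ᵢ ⊆ (Dᵐ ∖ S)ᵢ` with `h̄ᵢ α(x) ∈ M ∖ h̄ᵢ(S)`, parametrised by `c = α(x) ∈ T ∖ S`.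
[cite: Kosinski1993, VI §6] -/
def spanGlueData (h : ι → HandleAttachingMap n k M)
    (hdisj : Pairwise fun i j => Disjoint (range (h i).toFun) (range (h j).toFun)) :
    SpanGlueData (𝓡∂ (n + 1)) ↥(coresComplement h) ↥(beltPiece n k) ↥(sphereComplTube n k) ι where
  φA i c := ⟨(h i).toFun c, apply_mem_coresComplement h hdisj i c⟩
  φB _ c := handleInversionBelt c
  isSmoothEmbedding_φA i := isSmoothEmbedding_restrict h hdisj i
  isOpen_range_φA i := isOpen_range_restrict h hdisj i
  isSmoothEmbedding_φB _ := isSmoothEmbedding_handleInversionBelt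
  isOpen_range_φB _ := isOpen_range_handleInversionBelt
  disjoint i j hij := by
    show Disjoint (range _) (range _)
    rw [Set.disjoint_left]
    rintro _ ⟨c, rfl⟩ ⟨c', hc'⟩
    have he := congrArg Subtype.val hc'
    refine Set.disjoint_left.1 (hdisj hij) (mem_range_self (c : ↥(handleTube n k))) ?_
    rw [← show (h j).toFun c' = (h i).toFun c from he]
    exact mem_range_self _

variable (h : ι → HandleAttachingMap n k M)
  (hdisj : Pairwise fun i j => Disjoint (range (h i).toFun) (range (h j).toFun))

/-- The `A`-side of the `i`-th span is `h̄ᵢ`. [folklore] -/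
@[simp] theorem coe_spanGlueData_φA (i : ι) (c : ↥(sphereComplTube n k)) :
    (((spanGlueData h hdisj).φA i c : ↥(coresComplement h)) : M) = (h i).toFun c := rfl

/-- The `B`-side of the `i`-th span is `α`. [folklore] -/
@[simp] theorem spanGlueData_φB (i : ι) (c : ↥(sphereComplTube n k)) :
    (spanGlueData h hdisj).φB i c = handleInversionBelt c := rfl

/-- **The gluing relation of the span datum is Kosinski's `x ∼ h̄ᵢ α(x)`**
(`HandleAttachingMap.glueRel`). [cite: Kosinski1993, VI §6] -/
theorem link_spanGlueData_iff {i : ι} {a : ↥(coresComplement h)} {b : ↥(beltPiece n k)} :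
    (spanGlueData h hdisj).link i a b ↔ (h i).glueRel (a : M) (b : 𝔻 (n + 1)) := by
  constructor
  · rintro ⟨c, rfl, rfl⟩
    exact ⟨c, c.2, rfl, rfl⟩
  · rintro ⟨y, hy, hb, ha⟩
    refine ⟨⟨y, hy⟩, Subtype.ext ha.symm, ?_⟩
    apply Subtype.ext; apply Subtype.ext
    exact hb.symm

omit [T2Space M] [IsManifold (𝓡∂ (n + 1)) ∞ M] in
/-- **Near the attaching sphere, `h̄` takes values in any neighbourhood of `h̄(S)`**: for an open
`W ⊇ h̄(S)` there is `ε > 0` with `h̄{|y_λ|² > 1 - ε} ⊆ W` (compactness of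
`{1/2 ≤ |y_λ|²} ⊆ T`). [folklore] -/
theorem exists_lamSq_gt_imp_mem (f : HandleAttachingMap n k M) {W : Set M} (hW : IsOpen W)
    (hKW : f.core ⊆ W) :
    ∃ ε : ℝ, 0 < ε ∧ ∀ y : ↥(handleTube n k),
      1 - ε < lamSq k (((y : 𝔻 (n + 1)) : 𝔼 (n + 1))) → f.toFun y ∈ W := by
  set L : ↥(handleTube n k) → ℝ := fun y => lamSq k (((y : 𝔻 (n + 1)) : 𝔼 (n + 1))) with hL
  have hLc : Continuous L := continuous_lamSq_handleTube n k
  set Q : Set ↥(handleTube n k) := {y | 1 / 2 ≤ L y} ∩ {y | f.toFun y ∉ W} with hQ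
  have h1 : IsCompact {y : ↥(handleTube n k) | 1 / 2 ≤ L y} := by
    rw [Topology.IsEmbedding.subtypeVal.isCompact_iff]
    have : Subtype.val '' {y : ↥(handleTube n k) | 1 / 2 ≤ L y} =
        {u : 𝔻 (n + 1) | 1 / 2 ≤ lamSq k (u : 𝔼 (n + 1))} := by
      ext u
      constructor
      · rintro ⟨y, hy, rfl⟩; exact hy
      · intro hu
        have hu' : (1 / 2 : ℝ) ≤ lamSq k (u : 𝔼 (n + 1)) := hu
        refine ⟨⟨u, ?_⟩, hu, rfl⟩
        rw [mem_handleTube]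
        intro h0
        rw [h0] at hu'
        norm_num at hu'
    rw [this]
    exact (isClosed_le continuous_const ((continuous_lamSq k).comp continuous_subtype_val)).isCompact
  have hQc : IsCompact Q := h1.inter_right (hW.preimage f.continuous).isClosed_compl
  -- on `Q`, `L < 1`
  have hQlt : ∀ y ∈ Q, L y < 1 := by
    intro y hy
    refine lt_of_le_of_ne (lamSq_le_one (mem_closedBall_zero_iff.1 (y : 𝔻 (n + 1)).2)) fun h1' => ?_
    exact hy.2 (hKW ⟨y, h1', rfl⟩)
  rcases Q.eq_empty_or_nonempty with hQe | hQne
  · refine ⟨1 / 2, by norm_num, fun y hy => ?_⟩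
    by_contra hyW
    have : y ∈ Q := ⟨by change (1 / 2 : ℝ) ≤ L y; linarith, hyW⟩
    rw [hQe] at this
    exact this
  · obtain ⟨y₀, hy₀, hmax⟩ := hQc.exists_isMaxOn hQne hLc.continuousOn
    have hm : L y₀ < 1 := hQlt y₀ hy₀
    refine ⟨min (1 / 2) (1 - L y₀), lt_min (by norm_num) (by linarith), fun y hy => ?_⟩
    by_contra hyW
    have hε1 : min (1 / 2 : ℝ) (1 - L y₀) ≤ 1 / 2 := min_le_left _ _
    have hε2 : min (1 / 2 : ℝ) (1 - L y₀) ≤ 1 - L y₀ := min_le_right _ _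
    have hyQ : y ∈ Q := ⟨by change (1 / 2 : ℝ) ≤ L y; linarith, hyW⟩
    have := hmax hyQ
    change L y ≤ L y₀ at this
    change 1 - min (1 / 2 : ℝ) (1 - L y₀) < L y at hy
    linarith

/-- **The images `{(h̄ᵢ c, α c) | c ∈ T ∖ S}` of the spans are closed** in
`(M ∖ ⋃ⱼ h̄ⱼ(S)) × (Dᵐ ∖ S)` — the condition making the identification space Hausdorff
(Kosinski VI §1, proof of (1.1): "routine case-by-case checking").  Off the belt disc the image is
the graph of the continuous map `b ↦ h̄ᵢ α(b)`; a limit point `(a, b)` with `b` on the belt disc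
`{x_λ = 0}` would need `a ∈ h̄ᵢ(S)`, which has been removed (`exists_lamSq_gt_imp_mem`).
[cite: Kosinski1993, VI §1 proof of (1.1)] -/
theorem isClosed_link (i : ι) :
    IsClosed {p : ↥(coresComplement h) × ↥(beltPiece n k) | (spanGlueData h hdisj).link i p.1 p.2} := by
  set d := spanGlueData h hdisj with hd
  set f := h i with hf
  rw [← isOpen_compl_iff, isOpen_iff_mem_nhds]
  rintro ⟨a₀, b₀⟩ hp₀
  rw [mem_compl_iff, mem_setOf_eq] at hp₀
  by_cases hb₀ : lamSq k (((b₀ : 𝔻 (n + 1)) : 𝔼 (n + 1))) = 0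
  · -- `b₀` on the belt disc: `a₀` is off the (removed) attaching sphere `h̄ᵢ(S)`
    have ha₀ : (a₀ : M) ∉ f.core := (mem_coresComplement h).1 a₀.2 i
    have hdis : Disjoint (𝓝ˢ f.core) (𝓝 (a₀ : M)) :=
      f.isCompact_core.disjoint_nhdsSet_left.2 fun x hx =>
        disjoint_nhds_nhds.2 fun hxa => ha₀ (hxa ▸ hx)
    obtain ⟨V, hV, U, hU, hVU⟩ := Filter.disjoint_iff.1 hdis
    obtain ⟨W, hWo, hKW, hWV⟩ := mem_nhdsSet_iff_exists.1 hV
    obtain ⟨ε, hε, hεW⟩ := exists_lamSq_gt_imp_mem f hWo hKW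
    have hN : {p : ↥(coresComplement h) × ↥(beltPiece n k) |
        (p.1 : M) ∈ U ∧ lamSq k (((p.2 : 𝔻 (n + 1)) : 𝔼 (n + 1))) < ε} ∈ 𝓝 (a₀, b₀) := by
      refine Filter.inter_mem ?_ ?_
      · exact (continuous_subtype_val.continuousAt.comp continuousAt_fst).preimage_mem_nhds hU
      · refine (isOpen_lt ((continuous_lamSq_beltPiece n k).comp continuous_snd)
          continuous_const).mem_nhds ?_
        change lamSq k (((b₀ : 𝔻 (n + 1)) : 𝔼 (n + 1))) < ε
        rw [hb₀]; exact hε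
    refine Filter.mem_of_superset hN ?_
    rintro ⟨a, b⟩ ⟨haU, hbε⟩ ⟨c, hca, hcb⟩
    change (a : M) ∈ U at haU
    change lamSq k (((b : 𝔻 (n + 1)) : 𝔼 (n + 1))) < ε at hbε
    change d.φA i c = a at hca
    change d.φB i c = b at hcb
    rw [← hcb, spanGlueData_φB, lamSq_handleInversionBelt] at hbε
    have hcW : f.toFun c ∈ W := hεW c (by linarith)
    have hca' : f.toFun c = (a : M) := congrArg Subtype.val hca
    exact Set.disjoint_left.1 hVU (hWV hcW) (hca' ▸ haU)
  · -- `b₀` off the belt disc: near `b₀` the image is the graph of `b ↦ h̄ᵢ α(b)`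
    haveI : Nonempty ↥(handleTube n k) := ⟨handleInversionPt (b₀ : 𝔻 (n + 1)) hb₀ b₀.2⟩
    have hGc : ContinuousAt (fun b : ↥(beltPiece n k) => f.toFun (handleInversionPH n k b)) b₀ :=
      f.continuous.continuousAt.comp ((handleInversionPH n k).continuousAt hb₀)
    -- points of the image satisfy `a = h̄ᵢ (α b)`
    have hgraph : ∀ p : ↥(coresComplement h) × ↥(beltPiece n k), d.link i p.1 p.2 →
        (p.1 : M) = f.toFun (handleInversionPH n k p.2) := by
      rintro p ⟨c, hca, hcb⟩
      rw [← hca, ← hcb]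
      change f.toFun c = f.toFun (handleInversionPH n k (handleInversionBelt c))
      rw [handleInversionPH_handleInversionBelt]
    -- `(a₀, b₀)` is not on the graph
    have hne : (a₀ : M) ≠ f.toFun (handleInversionPH n k b₀) := by
      intro he
      apply hp₀
      have hb₀t : handleInversionPH n k b₀ ∈ sphereComplTube n k :=
        (handleInversionPH n k).map_source hb₀
      refine ⟨⟨handleInversionPH n k b₀, hb₀t⟩, Subtype.ext he.symm, ?_⟩
      rw [spanGlueData_φB, handleInversionBelt_eq]
      exact (handleInversionPH n k).left_inv hb₀
    have hc2 : ContinuousAt (fun p : ↥(coresComplement h) × ↥(beltPiece n k) =>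
        ((p.1 : M), f.toFun (handleInversionPH n k p.2))) (a₀, b₀) :=
      (continuous_subtype_val.continuousAt.comp continuousAt_fst).prodMk
        (ContinuousAt.comp (f := Prod.snd) (x := (a₀, b₀)) hGc continuousAt_snd)
    have ho : IsOpen {q : M × M | q.1 ≠ q.2} := isClosed_diagonal.isOpen_compl
    refine Filter.mem_of_superset (hc2.preimage_mem_nhds (ho.mem_nhds hne)) ?_
    intro p hp hlink
    exact hp (hgraph p hlink)

/-- **`M` with handles attached is compact when `M` is**: the glued space is covered by the images
of the compact sets `M ∖ ⋃ᵢ h̄ᵢ{|y_λ|² > 1/2}` and `{|x_λ|² ≤ 1/2} ⊆ Dᵐ ∖ S` (the inversion `α`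
exchanges `{|y_λ|² > 1/2}` and `{|x_λ|² < 1/2}`). [cite: Kosinski1993, VI §6] -/
theorem compactSpace_spanGlued [CompactSpace M] : CompactSpace (spanGlueData h hdisj).Glued := by
  set d := spanGlueData h hdisj with hd
  set O : Set M := ⋃ i, (h i).toFun ''
    {y : ↥(handleTube n k) | 1 / 2 < lamSq k (((y : 𝔻 (n + 1)) : 𝔼 (n + 1)))} with hO
  have hOo : IsOpen O := isOpen_iUnion fun i =>
    (IsOpenEmbedding.mk (h i).isSmoothEmbedding.isEmbedding (h i).isOpen_range).isOpenMap _
      (isOpen_lt continuous_const (continuous_lamSq_handleTube n k))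
  have hOc : IsCompact Oᶜ := hOo.isClosed_compl.isCompact
  have hsub : Oᶜ ⊆ (coresComplement h : Set M) := by
    intro x hx
    rw [SetLike.mem_coe, mem_coresComplement]
    rintro i ⟨y, hy, rfl⟩
    refine hx (mem_iUnion.2 ⟨i, y, ?_, rfl⟩)
    change (1 / 2 : ℝ) < lamSq k (((y : 𝔻 (n + 1)) : 𝔼 (n + 1)))
    rw [(mem_attachingSphereSet n k).1 hy]
    norm_num
  set KA : Set ↥(coresComplement h) := Subtype.val ⁻¹' Oᶜ with hKA
  have hKAc : IsCompact KA := by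
    rw [Topology.IsEmbedding.subtypeVal.isCompact_iff, hKA, image_preimage_eq_of_subset]
    · exact hOc
    · rw [Subtype.range_coe]; exact hsub
  set KB : Set ↥(beltPiece n k) := {b | lamSq k (((b : 𝔻 (n + 1)) : 𝔼 (n + 1))) ≤ 1 / 2} with hKB
  have hKBc : IsCompact KB := by
    rw [Topology.IsEmbedding.subtypeVal.isCompact_iff]
    have : Subtype.val '' KB = {u : 𝔻 (n + 1) | lamSq k (u : 𝔼 (n + 1)) ≤ 1 / 2} := by
      ext u
      constructor
      · rintro ⟨b, hb, rfl⟩; exact hb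
      · intro hu
        have hu' : lamSq k (u : 𝔼 (n + 1)) ≤ 1 / 2 := hu
        refine ⟨⟨u, ?_⟩, hu, rfl⟩
        rw [mem_beltPiece]
        intro h1
        rw [h1] at hu'
        norm_num at hu'
    rw [this]
    exact (isClosed_le ((continuous_lamSq k).comp continuous_subtype_val) continuous_const).isCompact
  refine d.compactSpace_of_subset hKAc hKBc fun p => ?_
  rcases d.exists_inl_or_inr p with ⟨a, rfl⟩ | ⟨⟨i, b⟩, rfl⟩
  · by_cases ha : a ∈ KA
    · exact Or.inl (mem_image_of_mem _ ha)
    · have haO : (a : M) ∈ O := not_notMem.1 ha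
      obtain ⟨i, hi⟩ := mem_iUnion.1 haO
      obtain ⟨y, hy, hya⟩ := hi
      have hy1 : lamSq k (((y : 𝔻 (n + 1)) : 𝔼 (n + 1))) ≠ 1 := fun h1 =>
        (mem_coresComplement h).1 a.2 i ⟨y, h1, hya⟩
      set c : ↥(sphereComplTube n k) := ⟨y, hy1⟩ with hc
      refine Or.inr (mem_iUnion.2 ⟨i, d.φB i c, ?_, ?_⟩)
      · change lamSq k (((handleInversionBelt c : ↥(beltPiece n k)) : 𝔻 (n + 1)) : 𝔼 (n + 1)) ≤ 1 / 2
        rw [lamSq_handleInversionBelt]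
        change (1 / 2 : ℝ) < lamSq k (((y : 𝔻 (n + 1)) : 𝔼 (n + 1))) at hy
        change 1 - lamSq k (((y : 𝔻 (n + 1)) : 𝔼 (n + 1))) ≤ 1 / 2
        linarith
      · rw [← d.inl_φA]
        congr 1
        exact Subtype.ext hya
  · by_cases hb : b ∈ KB
    · exact Or.inr (mem_iUnion.2 ⟨i, mem_image_of_mem _ hb⟩)
    · have hb' : 1 / 2 < lamSq k (((b : 𝔻 (n + 1)) : 𝔼 (n + 1))) := not_le.1 hb
      have hb0 : lamSq k (((b : 𝔻 (n + 1)) : 𝔼 (n + 1))) ≠ 0 := by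
        intro h0; rw [h0] at hb'; norm_num at hb'
      have hb0' : 0 < lamSq k (((b : 𝔻 (n + 1)) : 𝔼 (n + 1))) :=
        lt_of_le_of_ne (lamSq_nonneg k _) (Ne.symm hb0)
      have hb1' : lamSq k (((b : 𝔻 (n + 1)) : 𝔼 (n + 1))) < 1 :=
        lt_of_le_of_ne (lamSq_le_one (mem_closedBall_zero_iff.1 (b : 𝔻 (n + 1)).2)) b.2
      set y : ↥(handleTube n k) := handleInversionPt (b : 𝔻 (n + 1)) hb0 b.2 with hy
      have hLy : lamSq k (((y : 𝔻 (n + 1)) : 𝔼 (n + 1))) =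
          1 - lamSq k (((b : 𝔻 (n + 1)) : 𝔼 (n + 1))) := by
        rw [hy, coe_coe_handleInversionPt]
        exact lamSq_handleInversion hb0' hb1'.le
      have hy1 : lamSq k (((y : 𝔻 (n + 1)) : 𝔼 (n + 1))) ≠ 1 := (handleInversion_mem hb0 b.2).2.2
      set c : ↥(sphereComplTube n k) := ⟨y, hy1⟩ with hc
      have hcb : d.φB i c = b := by
        apply Subtype.ext; apply Subtype.ext
        exact handleInversion_handleInversion hb0' hb1'
      refine Or.inl ⟨d.φA i c, ?_, ?_⟩
      · change (h i).toFun y ∈ Oᶜ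
        intro hO'
        obtain ⟨j, hj⟩ := mem_iUnion.1 hO'
        obtain ⟨y', hy', he⟩ := hj
        by_cases hji : j = i
        · subst hji
          have := (h j).injective he
          subst this
          change (1 / 2 : ℝ) < lamSq k (((y : 𝔻 (n + 1)) : 𝔼 (n + 1))) at hy'
          linarith
        · refine Set.disjoint_left.1 (hdisj hji) (mem_range_self y') ?_
          rw [he]; exact mem_range_self _
      · rw [d.inl_φA, hcb]

/-- **Attaching finitely many handles with disjoint attaching maps yields a manifold** — discharge
of the named fact `HandleAttachingMap.exists_isMultiAttachment` (`HandleAttachingMaps.lean`).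
For attaching maps `h̄ᵢ : T → M` (`i : ι` finite) of `λ`-handles with pairwise disjoint ranges on
a Hausdorff, second countable smooth `m`-manifold with boundary `M`, the identification space
`(M ∖ ⋃ᵢ h̄ᵢ(S)) ∪ ⋃ᵢ (Dᵐ ∖ S)ᵢ`, `x ∈ (T ∖ S)ᵢ ∼ h̄ᵢ α(x)` (`SpanGlueData.Glued` of
`HandleAttachingMap.spanGlueData`) is a Hausdorff, second countable smooth `m`-manifold with
boundary, compact if `M` is, and is `M` with the handles attached along the `h̄ᵢ`
(`HandleAttachingMap.IsMultiAttachment`): Kosinski's `M ∪ H^λ ∪ ⋯ ∪ H^λ` (VI §6; the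
smooth structure and the Hausdorffness of the identification space as in VI §1, proof of (1.1);
several handles, VI §11). [cite: Kosinski1993, VI §6] -/
theorem exists_isMultiAttachment_holds : HandleAttachingMap.exists_isMultiAttachment.{u} := by
  intro n k M _ _ _ _ _ ι _ h hdisj
  set d := spanGlueData h hdisj with hd
  haveI : T2Space d.Glued := d.t2Space_of_isClosed_link (isClosed_link h hdisj)
  haveI : SecondCountableTopology d.Glued := d.secondCountableTopology
  exact ⟨d.Glued, inferInstance, inferInstance, inferInstance, inferInstance, inferInstance,
    fun _ => compactSpace_spanGlued h hdisj, hdisj, d.inl, d.inr, d.isSmoothEmbedding_inl,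
    d.isOpen_range_inl, fun i => ⟨d.isSmoothEmbedding_inr i, d.isOpen_range_inr i⟩,
    d.range_inl_union_iUnion_range_inr,
    fun i a b => d.inl_eq_inr_iff.trans (link_spanGlueData_iff h hdisj),
    d.pairwise_disjoint_range_inr⟩

end HandleAttachingMap

end Handles

end Literature.Topology.FourManifolds

end
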